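import Summits.AnomalousDissipation.AnomalousDissipation.Theses.MirrorVariety
import Summits.AnomalousDissipation.AnomalousDissipation.Theorems.GalerkinSteadyZerothLaw.Negative.StokesStates
import Summits.AnomalousDissipation.AnomalousDissipation.Theorems.MirrorVarietyGalerkinSteadyZerothLawCellCore
import Literature.Analysis.FluidPDE.NSGalerkinStationary

/-!
# Route MirrorVariety (AnomalousDissipation) — `GalerkinSteadyZerothLawOfSplit`

Settles stmt-AnomalousDissipation-18439 (support item `GalerkinSteadyZerothLawOfSplit` of route
`AnomalousDissipation/MirrorVariety`): the GLUE of the strategist's decomposition of the crux `GalerkinSteadyZerothLaw`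
(stmt-AnomalousDissipation-2986) into its two split children,
`CellLaminarComponentReachesZero → CellLaminarComponentStaysLoud → GalerkinSteadyZerothLaw`.
(The composition is the planner's candidate proof `Split.lean`, attached as item evidence and registered as the line
`Cruxes/GalerkinSteadyZerothLaw/Lines/laminar_component_split.lean`; landed here with the two children as hypotheses.)

OBJECTS.  The cell force `f_cell = (sin 2πx cos 2πy, −cos 2πx sin 2πy, 0)`, i.e. the Fourier family `cellCoeff` on the
shell `(±1, ±1, 0)` (landed `Theorems/MirrorVarietyGalerkinSteadyZerothLawCellCore.lean`: exact Euler core,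
`−Δf = 8π²f`, laminar state `f/(8π²ν)` at every level `N ≥ 2`); the symmetry class `Fix τ` (coefficients vanish at `k`
with `k₀ + k₁` odd); `F_N(E) = {(c, ν) : c ∈ galerkinSubspace (modes N) ∩ Fix τ, 0 < ν, galerkinRHS (modes N) ν C_N c = 0,
Σ‖c_k‖² ≤ E}`; `Comp_N(E, ν₀)` = connected component of the laminar point `(C_N/(8π²ν₀), ν₀)` in `F_N(E)`.
* R = `CellLaminarComponentReachesZero`: ∃ `E, ν₀ > 0`, ∀ `ν₁ > 0`, frequently in `N`, `Comp_N(E, ν₀)` contains a state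
  with `ν ≤ ν₁`.
* L = `CellLaminarComponentStaysLoud`: ∀ `E, ν₀ > 0` ∃ `ν₁, ε, κ, N₁`: for `N ≥ N₁` every state of `Comp_N(E, ν₀)` with
  `κ/N² ≤ ν ≤ ν₁` has `ν · 4π² Σ|k|²‖c_k‖² ≥ ε`.

PROOF (`loudWitness_of_subs`, ~75 lines).  Instantiate both children at the cell family (`cellCoeff_eq_lambda`, `rfl`);
take `E, ν₀` from R and `ν₁, ε, κ, N₁` from L at `(E, ν₀)`; the crux's viscosities are `ν_j := min ν₁ ν₀ / (j + 2) → 0⁺`,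
the SAME for every resolution.  For each `j`: R at threshold `ν_j` holds frequently in `N`; intersect
(`Frequently.and_eventually`) with the eventual side conditions `N ≥ N₁`, `N ≥ 2`, `κ/N² ≤ ν_j`; in the component the
anchor has viscosity `ν₀ ≥ ν_j` and R's state has viscosity `≤ ν_j`, so by the intermediate value theorem on the
viscosity projection of the preconnected component (`exists_mem_connectedComponentIn_snd_eq`) the component meets the
slice `ν = ν_j` at a state `w`: real solenoidal, a zero of the cell-forced Galerkin field, `Σ‖w_k‖² ≤ E` (membership in
`F`), and LOUD by L (it lies in the resolved window).  The landed dictionary (`fieldOf` / `steadyState_fieldOf` /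
`integral_norm_sq_fieldOf` / `loudness_fieldOf`, `Theorems/GalerkinSteadyZerothLaw/Negative/StokesStates.lean`; the force
side as in `stub_coreForce`, `Theorems/MirrorVarietyGalerkinSteadyZerothLawStubCoreForce.lean`) turns `w` into an admissible
tested-form steady state of `f_cell` with `∫|U|² ≤ E` and `ν_j‖∇U‖² ≥ ε`; `crux_iff` (`Negative/LoadBearing.lean`) closes.

References: R. Temam, *Navier–Stokes Equations* (1979), Ch. II §1 (tested steady Galerkin form, (1.29));
P. H. Rabinowitz, *Some global results for nonlinear eigenvalue problems*, J. Funct. Anal. 7 (1971) (continua of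
solutions; here only the elementary IVT on a connected component is used).
-/

noncomputable section

-- `Summit.<Summit>.<Problem>` is the tree's mandated summit-side namespace (CONVENTIONS §2); deliberate duplicate.
set_option linter.dupNamespace false

open scoped InnerProductSpace Topology
open MeasureTheory Filter Set UnitAddTorus
open Literature.Analysis.FunctionSpaces Literature.Analysis.FunctionSpaces.Torus
open Literature.Analysis.FluidPDE Literature.Analysis.FluidPDE.Torus

namespace Summit.AnomalousDissipation.AnomalousDissipation.Theorems

namespace GalerkinSteadyZerothLaw.Split

open Summit.AnomalousDissipation.AnomalousDissipation.Theorems.GalerkinSteadyZerothLaw (cellCoeff cellShell stub_cellCoreTools)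
open Summit.AnomalousDissipation.AnomalousDissipation.Theses.MirrorVariety
  (GalerkinSteadyZerothLaw CellLaminarComponentReachesZero CellLaminarComponentStaysLoud GalerkinSteadyZerothLawOfSplit)
open Summit.AnomalousDissipation.AnomalousDissipation.Theorems.GalerkinSteadyZerothLaw.Negative
  (SteadyState BandLimited FrequentlyLoud LoudWitness crux_iff fieldOf steadyState_fieldOf integral_norm_sq_fieldOf
    loudness_fieldOf)
open Summit.AnomalousDissipation.AnomalousDissipation.Theorems.LaminarNeverLoud.Negative
  (modes forceCoeff energy dissipation modes_symm zero_not_mem_modes)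

/-! ## §1 The cell family is its own explicit lambda; the cell force vector at level `N` -/

/-- `cellCoeff` is, definitionally, the explicit lambda written into the two split children. [folklore] -/
theorem cellCoeff_eq_lambda : cellCoeff = (fun l : Fin 3 → ℤ =>
    if l ∈ Fintype.piFinset ![({1, -1} : Finset ℤ), {1, -1}, {0}] then
      (Complex.I * (l 0 : ℂ) * (l 1 : ℂ) / 4) • !₂[-((l 1 : ℤ) : ℂ), ((l 0 : ℤ) : ℂ), 0] else 0) := rfl

/-- The zero-extension of the level-`2` cell vector is the whole family `cellCoeff` (support in `modes 2`). [folklore] -/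
theorem coeffExt_cell_two :
    coeffExt (modes (Fin 3) 2) (fun k : ↥(modes (Fin 3) 2) => cellCoeff k) = cellCoeff := by
  funext k
  by_cases hk : k ∈ modes (Fin 3) 2
  · rw [coeffExt_of_mem _ hk]
  · rw [coeffExt_of_not_mem _ hk, stub_cellCoreTools.1 k hk]

/-- **The cell force field.**  `f_cell := fieldOf 2 (cellCoeff|modes 2)` is smooth, divergence free, mean zero, square
integrable, and its Fourier force vector at EVERY level `N` is `cellCoeff` read on `modes N`
(`mFourierCoeff_realTrigPoly` + `coeffExt_cell_two`; this is the landed `stub_coreForce` of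
`Theorems/MirrorVarietyGalerkinSteadyZerothLawStubCoreForce.lean` run at `N₀ = 2` on the cell vector, re-derived
in five lines from the Literature API to keep this file's import closure inside the crux's `Negative/` chain). [folklore] -/
theorem cellForce_admissible :
    IsSmooth (fieldOf 2 (fun k : ↥(modes (Fin 3) 2) => cellCoeff k)) ∧
    IsDivFree (fieldOf 2 (fun k : ↥(modes (Fin 3) 2) => cellCoeff k)) ∧
    HasZeroMean (fieldOf 2 (fun k : ↥(modes (Fin 3) 2) => cellCoeff k)) ∧
    MemLp (fieldOf 2 (fun k : ↥(modes (Fin 3) 2) => cellCoeff k)) 2 volume ∧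
    ∀ N : ℕ, forceCoeff (modes (Fin 3) N) (fieldOf 2 (fun k : ↥(modes (Fin 3) 2) => cellCoeff k)) =
      fun k : ↥(modes (Fin 3) N) => cellCoeff k := by
  have hC₂ : (fun k : ↥(modes (Fin 3) 2) => cellCoeff k) ∈ galerkinSubspace (modes (Fin 3) 2) :=
    (stub_cellCoreTools.2 2 le_rfl).1
  have hS : ∀ k ∈ modes (Fin 3) 2, -k ∈ modes (Fin 3) 2 := modes_symm 2
  have hS0 : (0 : Fin 3 → ℤ) ∉ modes (Fin 3) 2 := zero_not_mem_modes 2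
  have hCsymm : IsConjSymm (coeffExt (modes (Fin 3) 2) (fun k : ↥(modes (Fin 3) 2) => cellCoeff k)) :=
    hC₂.1.isConjSymm_coeffExt hS
  have hCT : IsTransversal (modes (Fin 3) 2) (coeffExt (modes (Fin 3) 2) (fun k : ↥(modes (Fin 3) 2) => cellCoeff k)) :=
    hC₂.2.isTransversal_coeffExt
  have hfs : IsSmooth (fieldOf 2 (fun k : ↥(modes (Fin 3) 2) => cellCoeff k)) := isSmooth_realTrigPoly _ _
  refine ⟨hfs, isDivFree_realTrigPoly hCT, hasZeroMean_realTrigPoly_of_zero_not_mem hS0 _,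
    hfs.continuous.memLp_of_hasCompactSupport (HasCompactSupport.of_compactSpace _), fun N => ?_⟩
  funext k
  show mFourierCoeff (EuclideanSpace.complexify ∘
      realTrigPoly (modes (Fin 3) 2) (coeffExt (modes (Fin 3) 2) (fun k : ↥(modes (Fin 3) 2) => cellCoeff k)))
      (k : Fin 3 → ℤ) = cellCoeff k
  rw [mFourierCoeff_realTrigPoly hS hCsymm, coeffExt_cell_two]
  split_ifs with hk
  · rfl
  · exact (stub_cellCoreTools.1 k hk).symm

/-! ## §2 The intermediate value step on a component -/

/-- **IVT on the viscosity projection of a connected component.**  If the component of `x₀` in `F ⊆ X × ℝ` contains a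
point `z` with `z.2 ≤ a ≤ x₀.2`, it contains a point with second coordinate EXACTLY `a` (the continuous image of a
preconnected set in `ℝ` is order-connected). [folklore] -/
theorem exists_mem_connectedComponentIn_snd_eq {X : Type*} [TopologicalSpace X] {F : Set (X × ℝ)} {x₀ z : X × ℝ}
    (hz : z ∈ connectedComponentIn F x₀) {a : ℝ} (hza : z.2 ≤ a) (hax : a ≤ x₀.2) :
    ∃ w ∈ connectedComponentIn F x₀, w.2 = a := by
  have hx₀F : x₀ ∈ F := by
    by_contra h
    rw [connectedComponentIn_eq_empty h] at hz
    exact hz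
  have hx₀ : x₀ ∈ connectedComponentIn F x₀ := mem_connectedComponentIn hx₀F
  have hpre : IsPreconnected (Prod.snd '' connectedComponentIn F x₀) :=
    isPreconnected_connectedComponentIn.image _ continuous_snd.continuousOn
  have hsub := hpre.Icc_subset (mem_image_of_mem Prod.snd hz) (mem_image_of_mem Prod.snd hx₀)
  obtain ⟨w, hw, hwa⟩ := hsub ⟨hza, hax⟩
  exact ⟨w, hw, hwa⟩

/-! ## §3 The assembly from the two split children, and the route decl BY NAME -/

/-- **The crux's witness from the two split children.**  From R (`CellLaminarComponentReachesZero`) and L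
(`CellLaminarComponentStaysLoud`) the cell force `f_cell` is smooth, divergence free, mean zero and carries a
`LoudWitness`: instantiate both at the cell family (`rfl`); take `E, ν₀` from R and `ν₁, ε, κ, N₁` from L at `(E, ν₀)`;
the viscosities are `ν_j := min ν₁ ν₀ / (j + 2) → 0⁺`, the SAME for every resolution.  For each `j`: R (at threshold
`ν_j`) holds frequently in `N`; intersect with the eventual conditions `N ≥ N₁`, `κ/N² ≤ ν_j`; in the component the
anchor has viscosity `ν₀ ≥ ν_j` and R's state has viscosity `≤ ν_j`, so by the IVT
(`exists_mem_connectedComponentIn_snd_eq`) the component meets the slice `ν = ν_j` at a state `w`: real solenoidal, a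
zero of the cell-forced Galerkin field, `Σ‖w_k‖² ≤ E` (membership in `F`), and LOUD by L (it lies in the resolved
window).  The dictionary `fieldOf` / `steadyState_fieldOf` / Parseval turns `w` into an admissible tested-form state of
`f_cell` with `∫|U|² ≤ E` and `ν_j‖∇U‖² ≥ ε`. [folklore] -/
theorem loudWitness_of_subs (hR : CellLaminarComponentReachesZero) (hL : CellLaminarComponentStaysLoud) :
    ∃ f : UnitAddTorus (Fin 3) → EuclideanSpace ℝ (Fin 3), IsSmooth f ∧ IsDivFree f ∧ HasZeroMean f ∧ LoudWitness f := by
  -- both pieces at the cell family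
  obtain ⟨E, ν₀, hν₀, hreach⟩ := hR cellCoeff cellCoeff_eq_lambda
  obtain ⟨ν₁, ε, κ, hν₁, hε, N₁, hloud⟩ := hL cellCoeff cellCoeff_eq_lambda E ν₀ hν₀
  obtain ⟨hfs, hfd, hfm, hfmem, hfcoeff⟩ := cellForce_admissible
  -- the crux's viscosity sequence, the same for every resolution
  set m : ℝ := min ν₁ ν₀ with hm
  have hm0 : 0 < m := lt_min hν₁ hν₀
  set ν : ℕ → ℝ := fun j => m / ((j : ℝ) + 2) with hνdef
  have hνpos : ∀ j, 0 < ν j := fun j => by positivity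
  have hνle : ∀ j, ν j ≤ m := fun j => by
    have h2 : (1 : ℝ) ≤ (j : ℝ) + 2 := by
      have : (0 : ℝ) ≤ j := Nat.cast_nonneg j
      linarith
    exact div_le_self hm0.le h2
  have hνlim : Tendsto ν atTop (𝓝 0) := by
    have h1 : Tendsto (fun j : ℕ => (j : ℝ) + 2) atTop atTop :=
      tendsto_natCast_atTop_atTop.atTop_add tendsto_const_nhds
    exact tendsto_const_nhds.div_atTop h1
  refine ⟨fieldOf 2 (fun k : ↥(modes (Fin 3) 2) => cellCoeff k), hfs, hfd, hfm, ν, E, ε, hνpos, hνlim,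
    hε, fun j => ?_⟩
  -- eventual side conditions on the resolution
  have hκ : ∀ᶠ N : ℕ in atTop, κ / (N : ℝ) ^ 2 ≤ ν j := by
    have hsq : Tendsto (fun N : ℕ => (N : ℝ) ^ 2) atTop atTop :=
      (tendsto_pow_atTop two_ne_zero).comp tendsto_natCast_atTop_atTop
    have h0 : Tendsto (fun N : ℕ => κ / (N : ℝ) ^ 2) atTop (𝓝 0) := tendsto_const_nhds.div_atTop hsq
    exact h0.eventually (Iic_mem_nhds (hνpos j))
  have hev : ∀ᶠ N : ℕ in atTop, N₁ ≤ N ∧ κ / (N : ℝ) ^ 2 ≤ ν j := (eventually_ge_atTop N₁).and hκ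
  refine ((hreach (ν j) (hνpos j)).and_eventually hev).mono ?_
  rintro N ⟨hN, hN₁, hκN⟩
  obtain ⟨z, hzC, hzle⟩ := hN _ rfl _ rfl
  -- IVT: the component meets the slice `ν = ν j`
  have hνj0 : ν j ≤ ν₀ := (hνle j).trans (min_le_right _ _)
  have hνj1 : ν j ≤ ν₁ := (hνle j).trans (min_le_left _ _)
  obtain ⟨w, hwC, hw2⟩ := exists_mem_connectedComponentIn_snd_eq hzC hzle hνj0
  have hwF := connectedComponentIn_subset _ _ hwC
  simp only [Set.mem_setOf_eq] at hwF
  obtain ⟨hwV, -, -, hw0, hwE⟩ := hwF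
  -- non-depletion on the slice, in the resolved window
  have hwloud := hloud N hN₁ _ rfl _ rfl w hwC (by rw [hw2]; exact hκN) (by rw [hw2]; exact hνj1)
  rw [hw2] at hw0 hwloud
  -- the dictionary: coefficient state ↦ admissible tested-form field of the cell force
  refine ⟨fieldOf N w.1, steadyState_fieldOf hfmem hwV ?_, ?_, ?_⟩
  · rw [hfcoeff N]
    exact hw0
  · rw [integral_norm_sq_fieldOf hwV]
    exact hwE
  · rw [loudness_fieldOf (ν j) hwV]
    exact hwloud

end GalerkinSteadyZerothLaw.Split

open Summit.AnomalousDissipation.AnomalousDissipation.Theses.MirrorVariety (GalerkinSteadyZerothLawOfSplit) in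
open Summit.AnomalousDissipation.AnomalousDissipation.Theorems.GalerkinSteadyZerothLaw.Negative (crux_iff) in
/-- **The glue of the split** (stmt-AnomalousDissipation-18439; concludes the route decl BY NAME):
`CellLaminarComponentReachesZero → CellLaminarComponentStaysLoud → GalerkinSteadyZerothLaw` — the two split children
feed `GalerkinSteadyZerothLaw.Split.loudWitness_of_subs`, and the landed `crux_iff` (`Iff.rfl`) closes. [folklore] -/
theorem galerkinSteadyZerothLawOfSplit_proof :
    Summit.AnomalousDissipation.AnomalousDissipation.Theses.MirrorVariety.GalerkinSteadyZerothLawOfSplit := by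
  unfold GalerkinSteadyZerothLawOfSplit
  intro hR hL
  exact crux_iff.2 (GalerkinSteadyZerothLaw.Split.loudWitness_of_subs hR hL)

end Summit.AnomalousDissipation.AnomalousDissipation.Theorems

end

-- buildfix 2026-08-20 (ops-buildfix-1 gen 7): enqueue-only re-land — rebuild after B-35 (StokesArc, p233893) healed this module's import closure; no declaration changed.
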